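import Summits.ResolutionOfSingularities.ResolutionOfSingularities.Theorems.WeightedInvariantHypersurfaceCentreAssemblyPointDict
import Literature.AlgebraicGeometry.Resolution.StalkIdealLemmas
import Literature.AlgebraicGeometry.Resolution.IdealSheafLemmas
import Literature.AlgebraicGeometry.Resolution.CobordantBlowupExtReesLocalization
import HarnessLib

/-!
# Door assembly H2c″, stub [S6] — pullback of the pointwise data `ι_y`, `singImage` along charts (K4-A/B)

Route `ResolutionOfSingularities/WeightedInvariant`, crux `Theses.WeightedInvariant.HypersurfaceCentreConstruction`
(stmt-ResolutionOfSingularities-19897), door line `local-engine`, stub [S6] `stub_iotaMax_lt_of_step` (res-L1-w43-stub-9 =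
res-D-brk-1).  [S6] reads `ι` and the non-regular locus of the strict transform on the GLOBAL cobordant blow-up `B₊` through
the affine chart models `Spec A[t⁻¹, Jₙ tⁿ] ∖ Vert` (the open immersions `φ_U` of `…DatumToEmbeddedInvDrop`).  This def-free
file supplies the two transports:

* K4-A — along a morphism `g` whose stalk map at `v` is an isomorphism (open immersions): `iotaAt ι (K.comap g) v =
  iotaAt ι K (g v)` ((c6) + (c12a)) and `v ∈ singImage (K.comap g) ↔ g v ∈ singImage K`;
* K4-B — on an affine scheme `Spec C` with the ideal sheaf of an ideal `I ≤ C`: the stalk ideal at `𝔫` is `I · C_𝔫`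
  (`stalkIdeal_ofIdealTop_eq_map`), whence `iotaAt` and `singImage` in terms of the local ring `C_𝔫`.

OURS bookkeeping; no claim about Hironaka's problem. [folklore]
-/

noncomputable section

set_option linter.dupNamespace false -- mandated namespace of this single-conjunct summit

open CategoryTheory AlgebraicGeometry TopologicalSpace IsLocalRing
open Literature.AlgebraicGeometry.Resolution
open Summit.ResolutionOfSingularities.ResolutionOfSingularities.Theorems

namespace Summit.ResolutionOfSingularities.ResolutionOfSingularities.Cruxes.HypersurfaceCentreConstruction.LocalEngine

universe u

variable (ι : (R : Type) → [CommRing R] → R → Ordinal.{0})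

/-! ## K4-A: morphisms with invertible stalk map -/

section StalkIso

variable {V W : Scheme.{0}} (g : V ⟶ W) (K : W.IdealSheafData) (v : V) [IsIso (g.stalkMap v)]

/-- The stalk of the pulled-back ideal sheaf is the image of the stalk under the (invertible) stalk map. [folklore] -/
theorem stalkIdeal_comap_eq_map_ringEquiv :
    stalkIdeal (K.comap g) v = (stalkIdeal K (g v)).map
      ((asIso (g.stalkMap v)).commRingCatIsoToRingEquiv : W.presheaf.stalk (g v) →+* V.presheaf.stalk v) :=
  stalkIdeal_comap_eq_map_stalkMap g K v

/-- Support is reflected and preserved by a morphism with invertible stalk map. [folklore] -/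
theorem mem_support_comap_iff : v ∈ (K.comap g).support ↔ g v ∈ K.support := by
  let e := (asIso (g.stalkMap v)).commRingCatIsoToRingEquiv
  rw [mem_support_iff_stalkIdeal_le, mem_support_iff_stalkIdeal_le, stalkIdeal_comap_eq_map_ringEquiv]
  constructor
  · intro h x hx
    have hex : e x ∈ maximalIdeal (V.presheaf.stalk v) := h (Ideal.mem_map_of_mem _ hx)
    rw [IsLocalRing.mem_maximalIdeal, mem_nonunits_iff] at hex ⊢
    exact fun hu => hex (hu.map e)
  · intro h x hx
    rw [Ideal.map_comap_of_equiv, Ideal.mem_comap] at hx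
    have h1 := h hx
    rw [IsLocalRing.mem_maximalIdeal, mem_nonunits_iff] at h1 ⊢
    intro hu
    exact h1 (by simpa using hu.map e.symm)

/-- **`ι_v` is read on the target** along a morphism with invertible stalk map ((c6) iso-invariance, (c12a) unit
invariance of `ι`; the target stalk ideal principal). [folklore] -/
theorem iotaAt_comap_eq [IsDomain (V.presheaf.stalk v)] (hc6 : IotaIsoInvariant ι) (hu : IotaUnitInvariant ι)
    (hK : ∃ g₀ : W.presheaf.stalk (g v), stalkIdeal K (g v) = Ideal.span {g₀}) :
    iotaAt ι (K.comap g) v = iotaAt ι K (g v) := by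
  let e := (asIso (g.stalkMap v)).commRingCatIsoToRingEquiv
  have hW := stalkIdeal_eq_span_localGenerator K (g v) hK
  have hmap : stalkIdeal (K.comap g) v = Ideal.span {e (localGenerator K (g v))} := by
    rw [stalkIdeal_comap_eq_map_ringEquiv, hW, Ideal.map_span, Set.image_singleton]
    rfl
  have hV := stalkIdeal_eq_span_localGenerator (K.comap g) v ⟨_, hmap⟩
  unfold iotaAt
  rw [iota_eq_of_span_singleton_eq ι hu (hV.symm.trans hmap)]
  exact hc6 _ _ e _

/-- **The non-regular locus is read on the target** along a morphism with invertible stalk map. [folklore] -/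
theorem mem_singImage_comap_iff : v ∈ singImage (K.comap g) ↔ g v ∈ singImage K := by
  let e := (asIso (g.stalkMap v)).commRingCatIsoToRingEquiv
  by_cases hsupp : g v ∈ K.support
  · have hsupp' : v ∈ (K.comap g).support := (mem_support_comap_iff g K v).mpr hsupp
    rw [mem_singImage_iff_not_isRegularLocalRing_quotient _ hsupp',
      mem_singImage_iff_not_isRegularLocalRing_quotient _ hsupp]
    set I₁ := stalkIdeal K (g v) with hI₁
    set I₂ := stalkIdeal (K.comap g) v with hI₂
    have hI : I₂ = I₁.map (e : _ →+* _) := stalkIdeal_comap_eq_map_ringEquiv g K v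
    have q : (W.presheaf.stalk (g v) ⧸ I₁) ≃+* (V.presheaf.stalk v ⧸ I₂) := Ideal.quotientEquiv I₁ I₂ e hI
    refine ⟨fun h hreg => h ?_, fun h hreg => h ?_⟩
    · haveI := hreg; exact IsRegularLocalRing.of_ringEquiv q
    · haveI := hreg; exact IsRegularLocalRing.of_ringEquiv q.symm
  · have hsupp' : v ∉ (K.comap g).support := fun h => hsupp ((mem_support_comap_iff g K v).mp h)
    exact ⟨fun h => (hsupp' (mem_support_of_mem_singImage _ h)).elim,
      fun h => (hsupp (mem_support_of_mem_singImage _ h)).elim⟩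

end StalkIso

/-! ## K4-B: the affine model `Spec C` with the ideal sheaf of an ideal of `C` -/

section Affine

variable {C : Type} [CommRing C] (I : Ideal C) (𝔫 : (Spec (.of C) : Scheme.{0}))

/-- **Stalk of the ideal sheaf of `I ≤ C` on `Spec C`**: `I · 𝒪_{Spec C, 𝔫}` along `StructureSheaf.toStalk C 𝔫 : C → 𝒪_{Spec C,𝔫}`
(which is `algebraMap` for Mathlib's `StructureSheaf.stalkAlgebra`, an `IsLocalization.AtPrime _ 𝔫.asIdeal`). [folklore] -/
theorem stalkIdeal_ofIdealTop_eq_map :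
    stalkIdeal (Scheme.IdealSheafData.ofIdealTop (I.map (Scheme.ΓSpecIso (.of C)).inv.hom)) 𝔫 =
      I.map (StructureSheaf.toStalk C 𝔫).hom := by
  rw [stalkIdeal_eq_map_germ _ ⟨⊤, isAffineOpen_top _⟩ (Set.mem_univ _), ideal_ofIdealTop_top, Ideal.map_map]
  rfl

end Affine

/-! ## K4-D: reading `ι_y` and the non-regular locus through a ring isomorphism of the stalk -/

section ReadOff

variable {Y' : Scheme.{0}} (K' : Y'.IdealSheafData) (y' : Y') {O' : Type} [CommRing O']
  (Ψ : Y'.presheaf.stalk y' ≃+* O') {γ : O'} (hγ : (stalkIdeal K' y').map (Ψ : Y'.presheaf.stalk y' →+* O') = Ideal.span {γ})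

include hγ

/-- **`ι_{y'}` through a model of the stalk**: if `Ψ : 𝒪_{Y',y'} ≅ O'` carries the (principal) stalk `K'_{y'}` onto `(γ)`,
then `iotaAt ι K' y' = ι(O', γ)` ((c6), (c12a); `O'` a domain). [folklore] -/
theorem iotaAt_eq_of_map_ringEquiv [IsDomain O'] (hc6 : IotaIsoInvariant ι) (hu : IotaUnitInvariant ι)
    (hK : ∃ g₀ : Y'.presheaf.stalk y', stalkIdeal K' y' = Ideal.span {g₀}) : iotaAt ι K' y' = ι O' γ := by
  have hst := stalkIdeal_eq_span_localGenerator K' y' hK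
  have hspan : Ideal.span {Ψ (localGenerator K' y')} = Ideal.span {γ} := by
    rw [← hγ, hst, Ideal.map_span, Set.image_singleton]
    rfl
  unfold iotaAt
  rw [← hc6 _ _ Ψ (localGenerator K' y'), iota_eq_of_span_singleton_eq ι hu hspan]

/-- **A point of the non-regular locus has its local equation in `𝔪²` on the model**: if `Ψ : 𝒪_{Y',y'} ≅ O'` with `O'` a
regular local ring carries `K'_{y'}` onto `(γ)` and `y' ∈ singImage K'`, then `γ ∈ 𝔪_{O'}²` (Matsumura 14.2).
[cite: Matsumura1987, Thm. 14.2] -/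
theorem mem_maximalIdeal_sq_of_mem_singImage [IsRegularLocalRing O'] (h : y' ∈ singImage K') :
    γ ∈ maximalIdeal O' ^ 2 := by
  have hsupp := mem_support_of_mem_singImage K' h
  -- `γ ∈ 𝔪`: the stalk ideal is proper, and `Ψ` detects units
  have hγm : γ ∈ maximalIdeal O' := by
    have hle := (mem_support_iff_stalkIdeal_le K' y').mp hsupp
    have hγmem : γ ∈ (stalkIdeal K' y').map (Ψ : Y'.presheaf.stalk y' →+* O') := by
      rw [hγ]; exact Ideal.mem_span_singleton_self γ
    rw [Ideal.map_comap_of_equiv, Ideal.mem_comap] at hγmem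
    have h1 := hle hγmem
    rw [IsLocalRing.mem_maximalIdeal, mem_nonunits_iff] at h1 ⊢
    exact fun hu => h1 (by simpa using hu.map Ψ.symm)
  by_contra h2
  apply (mem_singImage_iff_not_isRegularLocalRing_quotient K' hsupp).mp h
  have hreg := (IsRegularLocalRing.quotient_span_singleton hγm h2).1
  have q : (Y'.presheaf.stalk y' ⧸ stalkIdeal K' y') ≃+* (O' ⧸ Ideal.span {γ}) :=
    Ideal.quotientEquiv _ _ Ψ hγ.symm
  exact IsRegularLocalRing.of_ringEquiv q.symm

end ReadOff

/-! ## Saturations `⋃ₙ (J : tⁿ)`: membership, localisation, transport -/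

section Saturation

variable {S : Type*} [CommRing S]

/-- Membership in `⋃ₙ (J : tⁿ)`. [folklore] -/
theorem mem_iSup_ideal_colon_singleton_pow_iff (J : Ideal S) (t x : S) :
    x ∈ (⨆ n : ℕ, J.colon {t ^ n}) ↔ ∃ n : ℕ, t ^ n * x ∈ J := by
  have hmono : Monotone fun n : ℕ => J.colon {t ^ n} := by
    refine monotone_nat_of_le_succ fun n f hf => ?_
    rw [Submodule.mem_colon_singleton, smul_eq_mul] at hf ⊢
    rw [pow_succ, ← mul_assoc]
    exact Ideal.mul_mem_right _ _ hf
  rw [Submodule.mem_iSup_of_directed _ hmono.directed_le]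
  simp only [Submodule.mem_colon_singleton, smul_eq_mul, mul_comm x]

/-- **Saturation commutes with localisation at a prime**: `(⋃ₙ (J : tⁿ)) S_𝔫 = ⋃ₙ (J S_𝔫 : (t/1)ⁿ)`. [folklore] -/
theorem map_iSup_colon_singleton_pow (𝔫 : Ideal S) [𝔫.IsPrime] (O : Type*) [CommRing O] [Algebra S O]
    [IsLocalization.AtPrime O 𝔫] (J : Ideal S) (t : S) :
    (⨆ n : ℕ, J.colon {t ^ n}).map (algebraMap S O) =
      ⨆ n : ℕ, (J.map (algebraMap S O)).colon {algebraMap S O t ^ n} := by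
  apply le_antisymm
  · rw [Ideal.map_le_iff_le_comap]
    intro x hx
    rw [Ideal.mem_comap, mem_iSup_ideal_colon_singleton_pow_iff]
    obtain ⟨n, hn⟩ := (mem_iSup_ideal_colon_singleton_pow_iff J t x).mp hx
    exact ⟨n, by rw [← map_pow, ← map_mul]; exact Ideal.mem_map_of_mem _ hn⟩
  · intro z hz
    obtain ⟨n, hn⟩ := (mem_iSup_ideal_colon_singleton_pow_iff _ _ z).mp hz
    obtain ⟨⟨x, s⟩, rfl⟩ := IsLocalization.mk'_surjective 𝔫.primeCompl z
    -- `tⁿ x / s ∈ J S_𝔫`: `c tⁿ x ∈ J` for some `c ∉ 𝔫`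
    have hmem : IsLocalization.mk' O (t ^ n * x) s ∈ J.map (algebraMap S O) := by
      rw [IsLocalization.mk'_eq_mul_mk'_one, map_mul, map_pow, mul_assoc, ← IsLocalization.mk'_eq_mul_mk'_one]
      exact hn
    rw [IsLocalization.mk'_mem_map_algebraMap_iff 𝔫.primeCompl] at hmem
    obtain ⟨c, hc, hcx⟩ := hmem
    -- so `c x ∈ (J : tⁿ)` and `x/s = (c x)/(c s)`
    have hcx' : c * x ∈ J.colon {t ^ n} := by
      rw [Submodule.mem_colon_singleton, smul_eq_mul]
      have : c * x * t ^ n = c * (t ^ n * x) := by ring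
      rw [this]; exact hcx
    have hxmem : c * x ∈ ⨆ n : ℕ, J.colon {t ^ n} := Submodule.mem_iSup_of_mem n hcx'
    have hunit : IsUnit (algebraMap S O c) := IsLocalization.map_units O ⟨c, hc⟩
    rw [← Ideal.unit_mul_mem_iff_mem _ hunit, IsLocalization.mul_mk'_eq_mk'_of_mul]
    exact IsLocalization.mk'_mem_iff.mpr (Ideal.mem_map_of_mem _ hxmem)

/-- **Transport of a saturation along a ring isomorphism** carrying `J` to `J'` and `t` to `t'`. [folklore] -/
theorem map_iSup_colon_singleton_pow_of_ringEquiv {S' : Type*} [CommRing S'] (h : S ≃+* S') (J : Ideal S) (J' : Ideal S')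
    (hJ : J.map (h : S →+* S') = J') (t : S) (t' : S') (ht : h t = t') :
    (⨆ n : ℕ, J.colon {t ^ n}).map (h : S →+* S') = ⨆ n : ℕ, J'.colon {t' ^ n} := by
  subst hJ ht
  ext y
  rw [Ideal.map_comap_of_equiv, Ideal.mem_comap, mem_iSup_ideal_colon_singleton_pow_iff, mem_iSup_ideal_colon_singleton_pow_iff]
  refine exists_congr fun n => ?_
  rw [Ideal.map_comap_of_equiv, Ideal.mem_comap, map_mul, map_pow, h.symm_apply_apply]

end Saturation

/-! ## The chart-to-game bridge at a prime, with the image of `t⁻¹` (res-type-048's package + (v)) -/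

section Package

open scoped LaurentPolynomial
open LaurentPolynomial

variable {A : Type} [CommRing A] {A' : Type} [CommRing A'] [Algebra A A']
  (F : IdealFiltration A) (M : Submonoid A) [IsLocalization M A']
  {I' : ℕ → Ideal A'} (hI' : ∀ n, I' n = (F.ideal n).map (algebraMap A A'))
  (𝔫 : Ideal F.extendedRees) [𝔫.IsPrime]
  (hd : Disjoint ((M.map (algebraMap A F.extendedRees) : Submonoid F.extendedRees) : Set F.extendedRees) 𝔫)

include M hI' hd

/-- **CHART → GAME SIDE at a prime** (res-type-048's `IdealFiltration.exists_prime_extReesAlgebra_ringEquiv_localization`,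
re-packaged WITH (v) the image of `t⁻¹`): a prime `𝔫'` of `extReesAlgebra I'` and `g : (⊕𝒥ₙtⁿ)_𝔫 ≃+* (extReesAlgebra I')_{𝔫'}`
with (i) matching structure maps from `A`, (ii) `t⁻¹ ∈ 𝔫' ↔ t⁻¹ ∈ 𝔫`, (iii) vertex iff irrelevant, (iv) base primes, and
(v) `g (t⁻¹/1) = t⁻¹/1`. [cite: Wlodarczyk2022, Def. 5.1.1] -/
theorem exists_prime_extReesAlgebra_ringEquiv_localization_T :
    ∃ (𝔫' : Ideal (extReesAlgebra I')) (_ : 𝔫'.IsPrime)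
      (g : Localization.AtPrime 𝔫 ≃+* Localization.AtPrime 𝔫'),
      (∀ a : A, g (algebraMap F.extendedRees (Localization.AtPrime 𝔫) (algebraMap A F.extendedRees a)) =
          algebraMap (extReesAlgebra I') _ (algebraMap A' (extReesAlgebra I') (algebraMap A A' a))) ∧
      (extReesAlgebra.tInv I' ∈ 𝔫' ↔ (⟨T (-1), F.T_neg_one_mem_extendedRees⟩ : F.extendedRees) ∈ 𝔫) ∧
      (extReesAlgebra.vertexIdeal I' ≤ 𝔫' ↔ F.irrelevant ≤ 𝔫) ∧
      (∀ 𝔭 : Ideal A, (𝔭.map (algebraMap A A')).map (algebraMap A' (extReesAlgebra I')) ≤ 𝔫' ↔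
          𝔭.map (algebraMap A F.extendedRees) ≤ 𝔫) ∧
      g (algebraMap F.extendedRees (Localization.AtPrime 𝔫) ⟨T (-1), F.T_neg_one_mem_extendedRees⟩) =
        algebraMap (extReesAlgebra I') _ (extReesAlgebra.tInv I') := by
  let F' : IdealFiltration A' :=
    { ideal := I'
      ideal_zero := by rw [hI' 0, F.ideal_zero, Ideal.map_top]
      antitone := fun m n h => by rw [hI' m, hI' n]; exact Ideal.map_mono (F.antitone h)
      mul_le := fun m n => by
        rw [hI' m, hI' n, hI' (m + n), ← Ideal.map_mul]
        exact Ideal.map_mono (F.mul_le m n) }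
  have heq : ∀ n, F'.ideal n = (F.ideal n).map (algebraMap A A') := hI'
  have hF'I : F'.ideal = I' := rfl
  obtain ⟨e, he⟩ := F'.exists_ringEquiv_extReesAlgebra hF'I
  haveI := F.isPrime_map_extendedReesMap F' M heq 𝔫 hd
  obtain ⟨g, hg⟩ := F.exists_ringEquiv_localization_extReesAlgebra F' M heq 𝔫 hd e
  refine ⟨_, inferInstance, g, fun a => F.ringEquiv_localization_algebraMap_base F' (fun n => (heq n).ge) e he 𝔫 _ g hg a,
    F.tInv_mem_iff_T_mem F' M heq 𝔫 hd e he, F.vertexIdeal_le_iff_irrelevant_le F' M heq 𝔫 hd e he hF'I,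
    fun 𝔭 => F.map_algebraMap_le_iff_map_algebraMap_le F' M heq 𝔫 hd e he 𝔭, ?_⟩
  rw [hg, F.extendedReesMap_T F' (fun n => (heq n).ge), ← F'.ringEquiv_tInv e he, e.symm_apply_apply]

end Package

end Summit.ResolutionOfSingularities.ResolutionOfSingularities.Cruxes.HypersurfaceCentreConstruction.LocalEngine

end
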